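import Literature.MathematicalPhysics.QuantumFieldTheory.Balaban1983to89.B10LogDet63
import Summits.QuantumFields.YangMills.Theorems.BalabanUVNodesK0RecordFormatNames

/-!
# NODE O port PT-A — (R-c) BOOKKEEPING, object-free: a FAMILY of walk-represented quantities `R_m` ([16] p.272: the members `Tr T^m` of (63)'s power series «analyzed in the same way»)
# with (23)-bounded walk terms `term_m` (constants `K_m`, uniform `q`, `r`) and summable coefficients `Σ_m |c_m|·K_m < ∞` REGROUPS INTO ONE localized family: the combined walk term
# `term′ b ω := Σ'_m c_m · term_m b ω` obeys (23) with `K′ = Σ'_m |c_m| K_m`, hence `B10LogDet63.logHalfBound_of_walks` applies (per-cube shape `B13.LogHalfBound` with `K′·V∕(1 − Dg·q)`)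

Cell `ym-nodeO-ideate`, porter seat `ymgap-nodeO-port-PTA-1` (gen 3); `--supports stmt-QuantumFields-27930` (helper; the BOOKKEEPING half of LZ-SPEC-v1's located generic gap (R-c) —
the remaining leaf is the walk representation of `(T^m)_{bb}` with constants `K_m` such that `Σ (2γ₁)^{−m}∕(2m) · K_m < ∞`, NODE O ∕ Literature-side).  [16] = [Balaban1985UV3],
[I] = [Balaban1987RG1].  Vocabulary of `B10LogDet63` §3 verbatim (cubes `Q`, sites `S`, walks `B9Thm37Sum.walksFrom`, domains `dom b ω`, spaces `sp`).
* §1 `norm_tsum_smul_le_of_bound` — `‖Σ' m, c_m • t_m‖ ≤ (Σ' m, |c_m| K_m) · w` from `‖t_m‖ ≤ K_m · w`.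
* §2 ★ `walkBound_tsum_family` — the combined term obeys (23) with `K′`; ★ `logHalfBound_tsum_family` — `LogHalfBound` for `Elog(term′)` with constant `K′·V∕(1 − Dg·q)` and rate `r`.
* §3 (v2 APPEND) ★★ `sum_Elog_tsum_family_eq` — `Σ_X Elog(term′) X φ = Σ'_m c_m · Σ_b R_m b φ` given the members' level-wise walk representations (absolute convergence in `(n, m)` + `tsum_comm'`).

HONEST FRAMING.  Bookkeeping over the tree's real-analysis lemma; NO walk representation and NO bound of Bałaban's is asserted; 27930 OPEN; K0⁷ NOT closed; NODE O 0∕1; COUNT 8∕28 · K 1∕4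
UNMOVED; finite `𝕋⁴_{L^K}` at fixed ε — NOT continuum ∕ OS ∕ Clay; **the Yang–Mills mass gap is NOT proved by any of this.**  No `sorry`, no `def`, no `instance`; standard axioms.
-/

noncomputable section

open scoped BigOperators Topology
open Finset

namespace Summit.QuantumFields.YangMills.Theorems.BalabanUVNodesPortS1

open Literature.MathematicalPhysics.QuantumFieldTheory.Balaban1983to89

/-! ## §1  A weighted series bound -/

/-- `‖Σ' m, c_m • t_m‖ ≤ (Σ' m, |c_m|·K_m) · w` whenever `‖t_m‖ ≤ K_m·w` and `Σ |c_m| K_m` converges. [cite: Balaban1985UV3, p.272 (after (63); bookkeeping)] -/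
theorem norm_tsum_smul_le_of_bound {M : Type*} (c : M → ℝ) (K : M → ℝ) (t : M → ℂ) {w : ℝ}
    (hK : Summable fun m => |c m| * K m) (ht : ∀ m, ‖t m‖ ≤ K m * w) :
    ‖∑' m, (c m : ℂ) * t m‖ ≤ (∑' m, |c m| * K m) * w := by
  have hmaj : HasSum (fun m => |c m| * K m * w) ((∑' m, |c m| * K m) * w) := (hK.hasSum).mul_right w
  refine tsum_of_norm_bounded hmaj fun m => ?_
  rw [norm_mul, Complex.norm_real, Real.norm_eq_abs, mul_assoc]
  exact mul_le_mul_of_nonneg_left (ht m) (abs_nonneg _)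

/-! ## §2  ★ The combined walk term and its per-cube bound -/

variable {D : LocDomainSys} [DecidableEq D.Dom] {Q : Type} [DecidableEq Q] {S : Type} [Fintype S] {Φ : Type*} {M : Type*}
  {nbrs : Q → Finset Q} {cube : S → Q} {dom : S → List Q → D.Dom} {cubes : D.Dom → Finset Q} {sp : D.Dom → Set Φ}
  {Dg V : ℕ} {q r : ℝ}

omit [DecidableEq D.Dom] [Fintype S] in
/-- ★ **THE COMBINED WALK TERM OBEYS (23)**: a family `term_m` of walk terms with `‖term_m b ω φ‖ ≤ K_m · q^{|ω|} · e^{−r d(dom b ω)}` on `sp (dom b ω)` and coefficients with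
`Σ |c_m| K_m < ∞` give `‖Σ' m, c_m · term_m b ω φ‖ ≤ K′ · q^{|ω|} · e^{−r d(dom b ω)}`, `K′ = Σ' m, |c_m| K_m` — the hypothesis `hterm` of `B10LogDet63.logHalfBound_of_walks` for
`term′ b ω φ := Σ' m, c_m · term_m b ω φ`. [cite: Balaban1985UV3, (23) p.262, p.272 (after (63))] -/
theorem walkBound_tsum_family (c : M → ℝ) (K : M → ℝ) (term : M → S → List Q → Φ → ℂ)
    (hK : Summable fun m => |c m| * K m)
    (hterm : ∀ m b n ω φ, ω ∈ B9Thm37Sum.walksFrom nbrs n (cube b) → φ ∈ sp (dom b ω) →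
      ‖term m b ω φ‖ ≤ K m * q ^ n * Real.exp (-(r * D.dj (dom b ω)))) :
    ∀ b n ω φ, ω ∈ B9Thm37Sum.walksFrom nbrs n (cube b) → φ ∈ sp (dom b ω) →
      ‖(fun b ω φ => ∑' m, (c m : ℂ) * term m b ω φ) b ω φ‖ ≤ (∑' m, |c m| * K m) * q ^ n * Real.exp (-(r * D.dj (dom b ω))) := by
  intro b n ω φ hω hφ
  rw [mul_assoc]
  refine norm_tsum_smul_le_of_bound c K (fun m => term m b ω φ) hK fun m => ?_
  rw [← mul_assoc]
  exact hterm m b n ω φ hω hφ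

/-- ★ **`LogHalfBound` FOR THE REGROUPED FAMILY**: under the counting hypotheses of `B10LogDet63.logHalfBound_of_walks` (`≤ Dg` neighbours, `≤ V` sites per cube, walks start in their
domain), `Dg·q < 1`, and the family bound of `walkBound_tsum_family`, the localized pieces `Elog(term′) X` obey `B13.LogHalfBound D sp … #cubes (K′·V∕(1 − Dg·q)) r` — the power-series
member of (63) localized with ONE per-cube constant, given the walk representations of its members. [cite: Balaban1985UV3, (23)–(25) p.262, p.272; Balaban1987RG1, (1.18) p.263] -/
theorem logHalfBound_tsum_family (c : M → ℝ) (K : M → ℝ) (term : M → S → List Q → Φ → ℂ)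
    (hD : ∀ cq, (nbrs cq).card ≤ Dg) (hV : ∀ cq : Q, (univ.filter fun b : S => cube b = cq).card ≤ V)
    (hstart : ∀ b n ω, ω ∈ B9Thm37Sum.walksFrom nbrs n (cube b) → cube b ∈ cubes (dom b ω))
    (hq : 0 ≤ q) (hDq : Dg * q < 1) (hK0 : ∀ m, 0 ≤ |c m| * K m) (hK : Summable fun m => |c m| * K m)
    (hterm : ∀ m b n ω φ, ω ∈ B9Thm37Sum.walksFrom nbrs n (cube b) → φ ∈ sp (dom b ω) →
      ‖term m b ω φ‖ ≤ K m * q ^ n * Real.exp (-(r * D.dj (dom b ω)))) :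
    B13.LogHalfBound D sp (B10LogDet63.Elog nbrs cube dom (fun b ω φ => ∑' m, (c m : ℂ) * term m b ω φ)) (fun X => (cubes X).card)
      ((∑' m, |c m| * K m) * V / (1 - Dg * q)) r :=
  B10LogDet63.logHalfBound_of_walks hD hV hstart (tsum_nonneg hK0) hq hDq (walkBound_tsum_family c K term hK hterm)

/-! ## §3  (v2 APPEND) ★★ The resummation identity: the localized pieces of the combined family reassemble `Σ_m c_m R_m` -/

/-- ★★ **THE RESUMMATION IDENTITY FOR THE FAMILY** (p.262 «Summing the expressions with the same localization X», applied to the power-series member of (63)): if each member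
`R_m b φ` HAS the level-wise walk representation `HasSum (n ↦ Σ_{|ω|=n} term_m b ω φ) (R_m b φ)` at a configuration `φ` lying in every space, then the localized pieces of the COMBINED
family reassemble the series: `Σ_X Elog(term′) X φ = Σ'_m c_m · Σ_b R_m b φ` (= `Σ_m c_m Tr T^m` when `R_m b = (T^m)_{bb}`).  Absolute convergence in `(n, m)` from the (23) bounds
(`|c_m|K_m · |S|·(Dg·q)^n`), then `Summable.tsum_comm'`. [cite: Balaban1985UV3, p.262 (before (24)), p.272 (after (63)); Balaban1987RG1, (1.7) p.261] -/
theorem sum_Elog_tsum_family_eq (c : M → ℝ) (K : M → ℝ) (term : M → S → List Q → Φ → ℂ)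
    (hD : ∀ cq, (nbrs cq).card ≤ Dg) (hV : ∀ cq : Q, (univ.filter fun b : S => cube b = cq).card ≤ V)
    (hstart : ∀ b n ω, ω ∈ B9Thm37Sum.walksFrom nbrs n (cube b) → cube b ∈ cubes (dom b ω))
    (hq : 0 ≤ q) (hDq : Dg * q < 1) (hr : 0 ≤ r) (hK0 : ∀ m, 0 ≤ K m) (hK : Summable fun m => |c m| * K m)
    (hterm : ∀ m b n ω φ, ω ∈ B9Thm37Sum.walksFrom nbrs n (cube b) → φ ∈ sp (dom b ω) →
      ‖term m b ω φ‖ ≤ K m * q ^ n * Real.exp (-(r * D.dj (dom b ω))))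
    (R : M → S → Φ → ℂ) (φ : Φ) (hφ : ∀ X, φ ∈ sp X)
    (hrep : ∀ m b, HasSum (fun n => ∑ ω ∈ B9Thm37Sum.walksFrom nbrs n (cube b), term m b ω φ) (R m b φ)) :
    ∑ X : D.Dom, B10LogDet63.Elog nbrs cube dom (fun b ω φ => ∑' m, (c m : ℂ) * term m b ω φ) X φ = ∑' m, (c m : ℂ) * ∑ b : S, R m b φ := by
  classical
  have hK0' : ∀ m, 0 ≤ |c m| * K m := fun m => mul_nonneg (abs_nonneg _) (hK0 m)
  -- termwise bound without the decay factor
  have hbd : ∀ m b n ω, ω ∈ B9Thm37Sum.walksFrom nbrs n (cube b) → ‖(c m : ℂ) * term m b ω φ‖ ≤ |c m| * K m * q ^ n := by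
    intro m b n ω hω
    rw [norm_mul, Complex.norm_real, Real.norm_eq_abs, mul_assoc]
    refine mul_le_mul_of_nonneg_left ?_ (abs_nonneg _)
    refine (hterm m b n ω φ hω (hφ _)).trans ?_
    have hexp : Real.exp (-(r * D.dj (dom b ω))) ≤ 1 := by
      rw [Real.exp_le_one_iff, neg_nonpos]
      exact mul_nonneg hr (D.dj_nonneg _)
    have hKq : 0 ≤ K m * q ^ n := mul_nonneg (hK0 m) (pow_nonneg hq n)
    calc K m * q ^ n * Real.exp (-(r * D.dj (dom b ω))) ≤ K m * q ^ n * 1 := mul_le_mul_of_nonneg_left hexp hKq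
      _ = K m * q ^ n := mul_one _
  -- summability in m at each (b, n, ω)
  have hsm : ∀ b n ω, ω ∈ B9Thm37Sum.walksFrom nbrs n (cube b) → Summable fun m => (c m : ℂ) * term m b ω φ := fun b n ω hω =>
    Summable.of_norm_bounded (hK.mul_right (q ^ n)) fun m => by simpa only using hbd m b n ω hω
  -- Step 1: the levels of the combined family are summable at φ for every X
  have hsumX : ∀ X : D.Dom, Summable fun n => B10LogDet63.level nbrs cube dom (fun b ω φ => ∑' m, (c m : ℂ) * term m b ω φ) X n φ :=
    fun X => B10LogDet63.summable_level hD hV hstart (tsum_nonneg hK0') hq hDq (walkBound_tsum_family c K term hK hterm) X (hφ X)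
  rw [B10LogDet63.sum_Elog_eq _ φ hsumX]
  -- Step 2: the double family g n m := c_m · Σ_b Σ_ω term_m and its summability
  set g : ℕ → M → ℂ := fun n m => (c m : ℂ) * ∑ b : S, ∑ ω ∈ B9Thm37Sum.walksFrom nbrs n (cube b), term m b ω φ with hg
  have hg_bound : ∀ n m, ‖g n m‖ ≤ (|c m| * K m) * ((Fintype.card S : ℝ) * ((Dg : ℝ) * q) ^ n) := by
    intro n m
    rw [hg]
    simp only []
    rw [Finset.mul_sum]
    refine (norm_sum_le _ _).trans ?_
    have hb : ∀ b : S, ‖(c m : ℂ) * ∑ ω ∈ B9Thm37Sum.walksFrom nbrs n (cube b), term m b ω φ‖ ≤ (|c m| * K m) * ((Dg : ℝ) * q) ^ n := by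
      intro b
      rw [Finset.mul_sum]
      refine (norm_sum_le _ _).trans ?_
      calc ∑ ω ∈ B9Thm37Sum.walksFrom nbrs n (cube b), ‖(c m : ℂ) * term m b ω φ‖
          ≤ ∑ _ω ∈ B9Thm37Sum.walksFrom nbrs n (cube b), |c m| * K m * q ^ n := sum_le_sum fun ω hω => hbd m b n ω hω
        _ = (B9Thm37Sum.walksFrom nbrs n (cube b)).card * (|c m| * K m * q ^ n) := by rw [sum_const, nsmul_eq_mul]
        _ ≤ (Dg : ℝ) ^ n * (|c m| * K m * q ^ n) := by
            refine mul_le_mul_of_nonneg_right ?_ (mul_nonneg (hK0' m) (pow_nonneg hq n))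
            exact_mod_cast B9Thm37Sum.card_walksFrom_le nbrs hD n (cube b)
        _ = (|c m| * K m) * ((Dg : ℝ) * q) ^ n := by rw [mul_pow]; ring
    calc ∑ b : S, ‖(c m : ℂ) * ∑ ω ∈ B9Thm37Sum.walksFrom nbrs n (cube b), term m b ω φ‖
        ≤ ∑ _b : S, (|c m| * K m) * ((Dg : ℝ) * q) ^ n := sum_le_sum fun b _ => hb b
      _ = (Fintype.card S : ℝ) * ((|c m| * K m) * ((Dg : ℝ) * q) ^ n) := by rw [sum_const, card_univ, nsmul_eq_mul]
      _ = (|c m| * K m) * ((Fintype.card S : ℝ) * ((Dg : ℝ) * q) ^ n) := by ring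
  have hDq0 : 0 ≤ (Dg : ℝ) * q := by positivity
  have hgeo : Summable fun n : ℕ => (Fintype.card S : ℝ) * ((Dg : ℝ) * q) ^ n := (summable_geometric_of_lt_one hDq0 hDq).mul_left _
  have hunc : Summable (Function.uncurry fun m n => g n m) := by
    refine Summable.of_norm_bounded (g := fun p : M × ℕ => (|c p.1| * K p.1) * ((Fintype.card S : ℝ) * ((Dg : ℝ) * q) ^ p.2)) ?_ fun p => hg_bound p.2 p.1
    exact summable_mul_of_summable_norm (f := fun m => |c m| * K m) (g := fun n : ℕ => (Fintype.card S : ℝ) * ((Dg : ℝ) * q) ^ n)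
      (hK.congr fun m => by rw [Real.norm_eq_abs, abs_of_nonneg (hK0' m)])
      (hgeo.congr fun n => by rw [Real.norm_eq_abs, abs_of_nonneg (by positivity)])
  have h1 : ∀ m, Summable fun n => g n m := fun m =>
    Summable.of_norm_bounded (hgeo.mul_left (|c m| * K m)) fun n => hg_bound n m
  have h2 : ∀ n, Summable fun m => g n m := fun n =>
    Summable.of_norm_bounded (hK.mul_right _) fun m => hg_bound n m
  -- Step 3: the inner finite sums commute with Σ'_m
  have hinner : ∀ n, ∑ b : S, ∑ ω ∈ B9Thm37Sum.walksFrom nbrs n (cube b), (∑' m, (c m : ℂ) * term m b ω φ) = ∑' m, g n m := by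
    intro n
    rw [hg]
    simp only [Finset.mul_sum]
    rw [Summable.tsum_finsetSum (fun b _ => summable_sum fun ω hω => hsm b n ω hω)]
    refine sum_congr rfl fun b _ => ?_
    rw [Summable.tsum_finsetSum (fun ω hω => hsm b n ω hω)]
  -- Step 4: swap and evaluate
  calc ∑' n, ∑ b : S, ∑ ω ∈ B9Thm37Sum.walksFrom nbrs n (cube b), (fun b ω φ => ∑' m, (c m : ℂ) * term m b ω φ) b ω φ
      = ∑' n, ∑' m, g n m := tsum_congr fun n => hinner n
    _ = ∑' m, ∑' n, g n m := (hunc.tsum_comm' h1 h2)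
    _ = ∑' m, (c m : ℂ) * ∑ b : S, R m b φ := by
        refine tsum_congr fun m => ?_
        rw [hg]
        simp only []
        rw [tsum_mul_left, Summable.tsum_finsetSum (fun b _ => (hrep m b).summable)]
        congr 1
        exact sum_congr rfl fun b _ => (hrep m b).tsum_eq

end Summit.QuantumFields.YangMills.Theorems.BalabanUVNodesPortS1

end
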